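import Summits.QuantumFields.QCD.Theses.DiagonalSpine
import Literature.MathematicalPhysics.QuantumFieldTheory.QCDGoldstoneBound
import HarnessLib

/-!
# Route `DiagonalSpine` (QCD): the support item `GoldstonePersistence` (stmt-QuantumFields-17437)

PERSISTENCE OF THE GOLDSTONE BOUND under reindexing: if `reg′` is `reg` composed with a strictly increasing `φ` and `reg` has
the eventual Goldstone lower bound (the hypothesis of the item is VERBATIM `reg.HasGoldstoneBound` unfolded,
`QCDRegularisation.hasGoldstoneBound_iff`), then so does `reg′` (`HasGoldstoneBound.of_comp`: `Tendsto`/`∀ᶠ` along `atTop`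
compose with `φ`) and `reg′.IsChiralAtZero` (`HasGoldstoneBound.isChiralAtZero`).  By name over the tree's Literature module
`QCDGoldstoneBound` (p131760).  Nothing is asserted about QCD beyond that; no summit, leg or crux statement is proved (width
seat ym-t4-w17 g0, free hands; the item carried three unlanded candidate proofs of 2026-08-16, unreadable from this seat).
-/

set_option autoImplicit false

namespace Summit.QuantumFields.QCD.Theorems

open Filter Literature.MathematicalPhysics.QuantumFieldTheory

/-- **Item stmt-QuantumFields-17437 `DiagonalSpine.GoldstonePersistence` holds.** [folklore] -/
theorem diagonalSpine_goldstonePersistence_proof :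
    Summit.QuantumFields.QCD.Theses.DiagonalSpine.GoldstonePersistence := by
  unfold Summit.QuantumFields.QCD.Theses.DiagonalSpine.GoldstonePersistence
  intro Nf reg reg' φ hφ ha hβ hL hmcrit hZm hG
  have hG0 : reg.HasGoldstoneBound := (QCDRegularisation.hasGoldstoneBound_iff reg).mpr hG
  have hG' : reg'.HasGoldstoneBound :=
    QCDRegularisation.HasGoldstoneBound.of_comp hφ.tendsto_atTop ha hβ hL hmcrit hZm hG0
  exact ⟨(QCDRegularisation.hasGoldstoneBound_iff reg').mp hG', hG'.isChiralAtZero⟩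

end Summit.QuantumFields.QCD.Theorems
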